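import Summits.SmoothPoincare4.SmoothPoincare4.Theses.CongruenceShadows
import Summits.SmoothPoincare4.SmoothPoincare4.Theorems.ShadowApproximation.Negative.ShadowsOnlyFalseFields
import Summits.SmoothPoincare4.SmoothPoincare4.Theorems.ShadowApproximation.Negative.UnitTwist

/-!
# Disproof of `ShadowApproximation` — findings (cdisprove gen 3, cycle 3, v7)

Work file of the standing disprover on crux `CongruenceShadows.ShadowApproximation`
(item `stmt-SmoothPoincare4-14595`, route `CongruenceShadows`, rank 5). Everything below is PROVED
(rc 0, no `sorry`, axioms `propext / Classical.choice / Quot.sound`) unless marked NEAR-MISS;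
prose only in docstrings. Index:

* §0 `Pairs`, `Shadows`, `shadowApproximation_iff` — the crux read back: `∀ m K`,
  `IsGroupTrisection (3+3m) (m+1) PUnit K →` Waldhausen-normalised `→` standard shadows mod every
  characteristic finite-index `M` `→ Iso N K`, `N = s4Kernels.stabilizeIter m` (`Iff.rfl`).
  Types align (`stabilizeIter m : TrisectionKernels (3 + 3*m)`, `stabilizeIter 0 = s4Kernels` by
  `rfl`); no junk operators; `Iso` is index-preserving over the FULL `Aut S_g` (orientation-
  reversing allowed: the weaker, safer conclusion); slot permutations of `N` are realised by
  handle-swap automorphisms (`Lines/weakly-reducible-knot-rigidity.lean`: `swap01`, `swap02`), so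
  no index-order counterexample.
* §1 NON-VACUITY `isGroupTrisection_std`, `hypotheses_hold_std`: `K = N` satisfies all three
  hypotheses for every `m` (discharged facts `s4Kernels_isGroupTrisection_holds`,
  `stabilize_isGroupTrisection_holds`), conclusion `Iso.refl`; the known models of the hypotheses
  are exactly the `Aut S_g`-orbit of `N` — and the crux says that is all of them.
* §2 LOGICAL POSITION (re-derived, sorry-free): `UnstableGate` (:= hypotheses minus shadows ⟹
  `Iso`) `→ ShadowApproximation`; `ShadowsStandard → (ShadowApproximation ↔ UnstableGate)`;
  `UnstableGate → NormalFormStablyTrivial`; `WaldhausenPairs → (ShadowApproximation ↔` its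
  `hW`-free form`)`. So ON THE LOAD PATH (GateLogic needs `ShadowsStandard`) the crux is
  `SPC4_g ∧` balanced 4-d Waldhausen at every genus (AGK arXiv:1605.06731 p.3: uniqueness of
  `(3k,k)` trisections of `{1}` "would prove more than the Poincaré conjecture … a 4-dimensional
  analog of Waldhausen"); off it, it is weaker than `UnstableGate` by exactly the shadow hypothesis.
* §3 LOAD-BEARING HYPOTHESES.
  - `hW` (normalisation): REDUNDANT given sibling item WaldhausenPairs (14592) — §2.
  - `hS` (shadows): dropping it gives `UnstableGate` = SPC4 ∧ 4dW; not refutable by any known object.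
  - `IsGroupTrisection`: LOAD-BEARING, machine-checked — LANDED as
    `Theorems/ShadowApproximation/Negative/ShadowsOnlyFalse.lean` (p73171, commit 28f826b26399;
    imported here, §3 restates it): the normal triple `J = (N₀, N₁, N₂ ⊓ ker θ)`,
    `θ : S₃ →* Perm ℤ`, `b₀ ↦ (0 1 2)`, `b₁ ↦ shift`, has ALL finite shadows standard (with `ψ = id`,
    for every finite-index NORMAL `M`: `Nᵢ ⊔ M = Jᵢ ⊔ M`, because `θ(N₂) = Alt_fin(ℤ)` has no proper
    shift-invariant finite-index subgroup) yet `¬ Iso N J` (`b₀` has order 3 in `S₃ ⧸ J₂`, while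
    `S₃ ⧸ N₂ ≅ F₃` is torsion-free). Statements `not_iso_of_shadows_only`,
    `shadowApproximation_false_without_isGroupTrisection(')`. MORAL: the congruence data are blind
    to perfect locally-finite sections; any proof must use the free-quotient / pair-quotient
    conditions (residual finiteness of `S ⧸ Kᵢ`, `S ⧸ KᵢKⱼ`) — complementary to the planner's
    unit-twist / lens-space phenomenon (rival HANDLEBODY triples with equal shadows, excluded by
    `free_pairQuotient`). WHICH FIELDS EXCLUDE `J` (landed follow-up
    `Negative/ShadowsOnlyFalseFields.lean`, p73918): `triple` HOLDS (`junk_triple`: `π₁ = 1`), pairs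
    `(0,1)`, `(1,2)` are free of rank 1, `free_quotient 0,1` hold; EXACTLY `free_quotient 2` and
    `free_pairQuotient (0,2)` fail (3-torsion) — so a proof must use the freeness of `S ⧸ K₂` or of
    one pair quotient; `π₁ = 1` + normality + level-wise equal shadows do not suffice.
  - NEAR-MISS (§5, not typable cheaply): keep `hW` + `hS`, drop only `triple`/freeness — rival =
    a balanced trisection of a homology 4-sphere whose `π₁` has no finite quotients (Kervaire +
    Higman group); shadows plausibly standard, `Iso` fails; formalising Higman's group
    (non-triviality needs Britton's lemma) is out of reach here.
* §4 WHY IT RESISTS (for provers/planners): a kill of the crux is a balanced group trisection of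
  `{1}` PROVED non-isomorphic to `N` whose finite shadows are all standard = a certified
  non-standard trisection of a homotopy 4-sphere (exotic `S⁴`, or a counterexample to MSZ
  Conj. 3.11 / 4-d Waldhausen at its own genus). None exists in print: MSZ16, AGK18;
  Islambouli-type non-isotopic trisections need `π₁ ≠ 1`; at `m = 0` exactly, Aranda–Zupan 2025
  (arXiv:2503.04607, read p.27): "A major open problem in trisection theory is whether there exists
  a non-standard trisection of `S⁴` … choosing a complicated tunnel number one knot `K ⊂ S¹×S³`
  with `[K]` generating `π₁` we can induce a `(3;1)`-trisection of `S⁴` that is a strong candidate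
  for being non-standard. Unfortunately, current techniques for obstructing reducibility of
  non-minimal trisections are limited" (their Prop 8.1 / Q 8.2 / Q 8.3; their Thm 1.3 classifies
  the MANIFOLDS with weakly reducible genus-3 trisections, not the trisections). So the `(K,τ,λ)`
  trisections of `S⁴` and the Gay–Meier Gluck-twist `(6;2)` diagrams are the candidate killers,
  with NO invariant separating them from `N`; and any FINITE-GROUP invariant that did separate
  one would falsify `hS` for that `K`, i.e. refute `ShadowsStandard` (14593), not this item. No
  `kit` computation bears on this item: `hS` quantifies over all levels and `¬ Iso` is the open
  part. `ledger negatives` for the summit: 0.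
* §5 TARGETS (lead's stubs; payload.targets = [] this cycle). Active line
  `weakly-reducible-knot-rigidity` (6 stubs): `WeakReduction`, `HullCoherence` are NECESSARY for
  the crux at `m = 0` (skeleton `open_stubs_necessary`), hence not cheaper to refute than the crux;
  `AZNormalForm`, `PrimitiveDestabilisation` quantify over genuine `(3;1)` group trisections of `{1}`
  (all known ones satisfy `Iso N K`), no junk instance; `ProfiniteFreeness` pins `c` to the
  `Aut S₃`-orbit of `a₁` (`IsCurve`), so `S₃ ⧸ (Kᵢ ⊔ ⟪c⟫)` is a compact-3-manifold group and the
  §3 junk (non-residually-finite quotient) cannot be injected; `HigherRungs` = the crux at `m ≥ 1`.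
  Nothing killed; no stub is weaker than "known in print" except the two necessary ones.
* §6 (CYCLE 2) UNITS OBSTRUCTION — the Artin STRONG form of the crux is FALSE, and the obstruction
  is SHARP at the abelian level. Artin 1969 gives an actual solution congruent to the formal one to
  any prescribed order; the analogue `StrongShadowApproximation` ("every level-`M` standardisation
  `ψ` of a normalised `K` is congruent mod `M` to an isomorphism `α : N → K`") and already its
  `K = N` case `LevelSymmetriesLift` ("`Stab(N₀M) ∩ Stab(N₁M) ∩ Stab(N₂M) = (Stab N₀ ∩ Stab N₁ ∩
  Stab N₂)·K_M`") fail at genus 3, level `M₅ = ⋂ ker (S₃ → 𝔽₅)`: the UNIT TWIST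
  `δ = τ_a³τ_b⁻²τ_a²τ_bτ_a⁻¹ ∈ Aut S₃` (Dehn twists about `a₀`, `b₀`; `≡ diag(3,2) (mod 5)` on
  `ℤ⟨a₀,b₀⟩`, the torus element `h(3) ∈ SL₂(𝔽₅)`) stabilises all three `Nᵢ ⊔ M₅` (LANDED:
  `Theorems/ShadowApproximation/Negative/UnitTwist.lean`, p75257 — `delta`, `delta_level`,
  `homZ5_delta`, `M5`; imported and restated in §6), yet every `α ∈ Stab N₀ ∩ Stab N₁` acts by `±1`
  on the pair quotient `S₃ ⧸ N₀N₁ ≅ ℤ = ⟨b₀⟩`, so `χ_{b₀}(α b₀) = ±1 ≠ 2 = χ_{b₀}(δ b₀)` in `𝔽₅`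
  (LANDED `Negative/LevelSymmetriesFalse.lean`, p77641, commit 27f73c2ddb02: `chi_alpha_b0`,
  `not_lift_delta`, `not_levelSymmetriesLift`, `not_strongShadowApproximation`; quoted in §6 —
  imported from v6 on, once the check farm has built it). SHARPNESS (new this cycle): the
  `±1`-normalised, UNIPOTENT level symmetries DO lift — the handle slide `σ₀₁ ∈ Aut S₃`
  (`a₀ ↦ a₀, b₀ ↦ a₀⁻¹a₁a₀·b₀, a₁ ↦ a₀⁻¹a₁a₀, b₁ ↦ a₁b₁a₁⁻¹·a₀`, handle 2 conjugated by `a₁`; found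
  by a free-group search, seat `py/search_mix2.py`, certified `py/slide_check.py` and in Lean)
  stabilises `N₀, N₁, N₂` EXACTLY and acts on every abelian quotient as `u : b₀ ↦ b₀ + a₁,
  b₁ ↦ b₁ + a₀` (LANDED `Negative/Slides.lean`, p77784: `slide01_stab`, `toCommGroup_comp_slide01`,
  `unipotent_level_symmetry_lifts`; quoted in §6, imported from v6 on); the per-handle sign `a₀ ↦
  (a₀b₀)a₀⁻¹(a₀b₀)⁻¹, b₀ ↦ (a₀b₀)b₀⁻¹(a₀b₀)⁻¹` also stabilises all `Nᵢ` (seat `py/signs_check.py`).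
  UPSHOT at an abelian level `M ⊇ [S,S]`: the joint stabiliser of the three Lagrangian shadows is
  (unit torus `aᵢ ↦ uᵢaᵢ, bᵢ ↦ uᵢ⁻¹bᵢ`) ⋉ (3-parameter unipotent `b₀ ↦ b₀ + xa₁ + ya₂, …`), the
  image of `Stab N₀ ∩ Stab N₁ ∩ Stab N₂` contains `{±1}³ ⋉ unipotents`, and by `chi_alpha_b0`
  (applied to each pair) nothing with a unit scalar `∉ {±1}`: a level symmetry lifts IFF its three
  unit scalars (its action on the pair quotients `S ⧸ NᵢNⱼM ≅ ℤ/n`) are `±1`. MORAL: any proof must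
  NORMALISE the `ψ_M` by unit twists on `N`'s side (they stabilise every `NᵢM` and adjust the three
  scalars independently — survivors `b₀, b₁, b₂` of the pairs `(0,1), (0,2), (1,2)`) — after which
  the abelian level is no obstruction at all; the crux's coherence problem begins in earnest at
  the metabelian / Johnson levels (next rung for cycle 3: do `±1`-normalised symmetries of the
  level-`M` shadows lift for `M = ` the third term of the lower central / derived `p`-series?).
* §7 (CYCLE 2) TIGHTNESS / DICHOTOMY `eq_of_idShadows`: if the level-wise standardisations can be
  taken to be the identity (`Kᵢ ⊔ M = Nᵢ ⊔ M` at every characteristic finite-index `M`) and both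
  `Kᵢ`, `Nᵢ` are closed for that family of levels (`CharSeparable` — true for handlebody kernels:
  `S ⧸ Kᵢ ≅ F_g` is residually finite and finite-index subgroups of the f.g. group `S` contain
  characteristic finite-index ones; not formalised, F_g residually finite is not in Mathlib), then
  `K = N` outright. With §3 this is a clean dichotomy: gen 1's junk `J₂` has identity shadows and
  is NOT separable (`S₃ ⧸ J₂ ↠ θ(S₃) ⊇ Alt_fin(ℤ)`); for genuine trisections identity shadows force
  equality, so ALL the difficulty of the crux is the `M`-dependence of `ψ_M` (§6).
* §8 (GEN 3, CYCLE 3) UNITS NEVER DIE — the units obstruction is NOT a shallow-level artefact.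
  Gen 2's `δ` is the member `δ(3,2)` of a two-parameter family of unit twists
  `δ(t,t') = τ_aᵗ ∘ τ_b^{-t'} ∘ τ_a^{t-1} ∘ τ_b ∘ τ_a⁻¹ ∈ Aut S₃` (handle `0`; matrix
  `[[t(1-N), N], [-N, t']]`, `N = tt'-1`). MECHANISM: `δ(t,t') a₀ ≡ b₀^{-N}` modulo `a₀` (hence
  modulo `N₀` and modulo `N₁`), `δ(t,t') b₀ ≡ a₀^{N}` modulo `b₀` (hence modulo `N₂`), the other
  generators are fixed, and modulo `a₀` the survivor `b₀` is multiplied by the unit `t'`. HENCE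
  (Lean, seat `Tower.lean` rc 0; landing as `Negative/UnitTwistTower.lean`, proposal submitted when
  the gate returns — see seat NOTES for the p-id): (i) `deltaT_level` — for EVERY characteristic
  finite-index `M ⊇ S₃ⁿ` with `n ∣ tt'-1`, `δ(t,t')(NᵢM) = NᵢM`, `i = 0,1,2`; (ii) `unit_twist_tower`
  — `δ = δ(3,2)` is a NON-liftable level symmetry at every characteristic f.i. `M` with
  `S₃⁵ ⊆ M ⊆ M₅`, i.e. along the whole lower exponent-5 central series `γ_{c+1}(S₃)S₃⁵`
  (unbounded class), not just at `M₅`; (iii) `levelSymmetriesLift_fails_cofinally` — for EVERY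
  characteristic f.i. `M₀` the deeper level `M = M₀ ⊓ M₅` carries the non-liftable symmetry
  `δ(t,t')` with `n = [S₃:M]`, `t' = (ordCompl[5] n)⁴ + 1 ≡ 2 (mod 5)` (Fermat), `t = t'⁻¹ (mod n)`;
  (iv) `not_eventualLevelSymmetriesLift` — the natural weakening of §6's LevelSymmetriesLift,
  "beyond some level `M₀` every level symmetry of the shadow triple is congruent mod `M` to a
  symmetry of `(N₀,N₁)`", is FALSE (§8 below states it as `EventualLevelSymmetriesLift`, implied by
  `LevelSymmetriesLift`). CONSEQUENCES: (a) a proof of the crux must renormalise the three unit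
  scalars of the given `ψ_M` at EVERY level, coherently in `M` — three independent
  `(ℤ/n)ˣ/±1`-torsors, one per pair of slots (survivors `b₀, b₁, b₂`); (b) COMPACTNESS: the inverse
  limit over levels of the (non-empty, finite) sets "level-`M` symmetries with scalar `2` on `b₀`
  mod 5" is non-empty, so the stabiliser of the closed triple `(N̂₀,N̂₁,N̂₂)` in the congruence
  completion `cl(Aut S₃) ≤ Aut Ŝ₃` STRICTLY contains `cl(Stab N₀ ∩ Stab N₁ ∩ Stab N₂)` — the
  TRIPLE (gate-locus) form of the planner's "CONG is false" (route NOTES: single handlebody), now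
  with a machine-checked cofinal witness family; no "pro-stabiliser = closure" proof of the crux.
* §9 (GEN 3) NORMALISED SYMMETRIES AT NILPOTENCY CLASS 2 AND 3 (seat computations `py/surf.py`,
  `py/johnson3.py`, `py/iota.py`, `py/class3.py`; exact arithmetic over `𝔽₅`, all integral;
  Dehn's algorithm for `S₃`, exponential/BCH coordinates, Lazard for class `3 < p`). New exact
  symmetries of `N` found and verified: the ROTATION `ρ : aᵢ ↦ aᵢ₊₁, bᵢ ↦ bᵢ₊₁` permutes the slots
  (`ρN₀ = N₂, ρN₁ = N₀, ρN₂ = N₁`, so it normalises `G_N := Stab N₀ ∩ Stab N₁ ∩ Stab N₂`); the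
  handle signs `εᵢ` (`ε₀² = T_{c₀}`, the separating twist = conjugation of handle `0` by `[a₀,b₀]`);
  the three slides `σ₀₁, ρσ₀₁ρ⁻¹, ρ²σ₀₁ρ⁻²`; and an orientation-REVERSING involution `ι ∈ G_N`
  (`aᵢ ↦ wᵢaᵢwᵢ⁻¹, bᵢ ↦ wᵢbᵢ⁻¹wᵢ⁻¹`, `w₀ = c₂⁻¹c₁⁻¹b₀, w₁ = c₂⁻¹b₁, w₂ = b₂`, `cᵢ = [aᵢ,bᵢ]`;
  `ι² = id`, acts as `diag(1,-1,1,-1,1,-1)` on `H`). CLASS 2 (level `V = γ₃(S₃)S₃ᵖ`, `p` odd; IA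
  image of `Aut S₃` in `Aut(S₃/V)` = contraction image of `Λ³H_p`, dim 20 — Johnson + BMS, checked
  on all Torelli elements used): the IA level symmetries of the TRIPLE form
  `D = ker(Λ³H → ⊕ᵢ Λ³(H/Λᵢ))` = trivectors with vanishing coefficients of `a₀b₁b₂, b₀a₁b₂, b₀b₁a₂`
  (dim 17; single handlebody 19, pair 18). LIFTABLE part realised by explicit elements of `G_N`
  (Johnson images of Torelli words in `εᵢ, σ's, T_{cᵢ}, ι, Inn`, computed EXACTLY via relator lifts
  of `(ℤ/2)⁴ ⋉ ℤ³` + `ℤ[G]`-closure): `D_lift ⊇ K`, dim `K = 10` (`H∧ω` from `Inn`, + `a₀b₀a₁,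
  a₀b₀a₂, a₀a₁b₁, a₀a₁a₂, a₀a₂b₂, a₁b₁a₂, a₁a₂b₂`). UNDECIDED: `D/K`, dim 7, spanned by the top
  powers of the three Lagrangians `Λ³Λ₀ = a₀a₁b₂, Λ³Λ₁ = a₀b₁a₂, Λ³Λ₂ = b₀a₁a₂`, three "two-b"
  directions `a₀b₀b₁, a₀b₀b₂, b₀a₁b₁` (mod `Inn`) and `b₀b₁b₂` — realised by `G_N` (unknown part)
  or genuinely non-liftable? CLASS 3 SIEVE (level `γ₄(S₃)S₃⁵`; IA image of Torelli =
  `{(d, q(d)+E)}`, `E = τ₂(Johnson kernel) ⊗ 𝔽₅ = 𝔽₅[Sp^±]·e(T_{c₀})`, dim `E = 104 = 90+14`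
  (`[2,2]⊕[1,1]`, matching Morita/Hain mod the pointed-surface `[0]`)): ALL 17 directions of `D`
  extend to IA class-3 level symmetries inside the Torelli image (`D₃ = D`; the sieve is void:
  every obstruction vector vanishes mod `cond(E)`, rank 18) — so class 3 gives NO certificate of
  non-liftability, and the unit twists persist at class 3 (`δ(3,2)` passes, as §8 proves in
  general). Johnson-kernel layer: IA class-3 symmetries with trivial class-2 part = `E ∩ C`, dim
  `104 - 18 = 86`; known liftable part (`T_{cᵢ}`, `Inn(γ₂)`, kernel combos, `G_N`-closure): see
  seat NOTES (`class3_p5b.log`). UPSHOT for provers/planners (sharpens §6's "next rung"): through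
  class 3 the ONLY certified obstruction to lifting level symmetries of `N` is the unit torus (§6,
  §8); `±1`-normalised symmetries are not known to fail to lift, and `≥ 10/17` of the class-2 IA
  ones provably lift. The seven directions `Λ³Λᵢ, …` are the concrete test case for any claimed
  description of `G_N` (the genus-3 trisection group of `S⁴`) or of the Johnson image of the
  handlebody/trisection Torelli groups (note: `τ(G_N ∩ I) ⊄ Λ²Λᵢ∧H + H∧ω`, so "BP maps of
  meridian pairs" do NOT exhaust the handlebody Torelli image — checked; indeed Morita's
  computation quoted in Faes 2023 (arXiv:2206.10687, p.3, after Levine) gives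
  `τ₁(handlebody group ∩ Torelli) = ker(D₁(H) → D₁(H'))`, the FULL kernel, for `Σ_{g,1}`).
  NEXT RUNG (literature-guided): the first level at which a `±1`-normalised symmetry can be
  CERTIFIED non-liftable is CLASS 4 — Faes 2023 Thm B: for handlebody-Torelli `φ`,
  `det r^{A,𝔞}(φ) = Tr^A_1(τ₁φ) ∈ H' ⊂ ℤ[H']` (the abelian-reduced Magnus determinant is a
  MONOMIAL), and Thm A: the Lagrangian traces `Tr^A_k` vanish on `τ_k` of the handlebody Johnson
  filtration, `k ≥ 2`, with `𝒢₂ ≠ τ₂(𝒜₂)`; so an IA level symmetry of the triple whose three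
  Magnus determinants (one per handlebody `Hᵢ`, Lagrangian `Λᵢ`) are not monomial to second
  order is not liftable — the "Alexander units" analogue of §6's unit scalars, invisible at class
  `≤ 3` (void sieve above) and decidable at class 4 by the same BCH machinery (`p ≥ 5`). A normal
  generating set of the handlebody Torelli group is in Omori 2019 (Geom. Dedicata 201); the
  handlebody Johnson–Morita theory is Habiro–Massuyeau 2026 (Selecta, arXiv:2401.07705, §11.1 for
  the comparison with the usual filtration). CANDIDATE new element of `G_N ∩ I` for ideators: the
  bounding-pair map `T_{b₂}T_{d'}⁻¹`, `d' = b₂·[a₀, y]`, `y` = band sum of `b₀` and `a₁` (class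
  `b₀ + a₁`): algebraically `d' ∈ N₀` and `d' ≡ b₂` in `S/N₁` and in `S/N₂` (meridian pair in `H₀`,
  annuli in `H₁`, `H₂` by Cannon–Feustel), so it should lie in `G_N` with
  `τ₁ = b₂∧a₀∧(b₀+a₁) = ±(a₀b₀b₂ + a₀a₁b₂)`, a NEW direction (`Λ³Λ₀` plus a two-b one); with its
  `ρ`-conjugates `K` would grow to `≥ 13`, leaving `b₀b₁b₂` and at most three more — unverified
  (needs a curve/twist engine), recorded as a near-miss for the lead and the ideators.
* §10 (GEN 3) ALEXANDER UNITS — `±1`-NORMALISED LEVEL SYMMETRIES NEED NOT LIFT (computational theorem,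
  seat `AlexanderUnits.md`, scripts `py/class3F.py`, `py/class3G.py`, log `py/class3G_p5.log`; attached as
  evidence). At the class-3 level `V = γ₄(S₃)S₃⁵` there is a 15-dimensional `𝔽₅`-space of automorphisms
  `ψ ∈ 𝒦 ≤ Aut S₃` (Johnson kernel: TRIVIAL on `S₃/γ₃(S₃)S₃⁵`, so all unit scalars are `+1`) with
  `ψ(NᵢV) = NᵢV` for `i = 0,1,2`, modulo those congruent mod `V` to elements of `G_N`, such that for some `i` NO
  `α ∈ Aut S₃` with `α(Nᵢ) = Nᵢ` is congruent to `ψ` mod `V` (rank 6 per handlebody, 15 jointly; candidates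
  `E_F ∩ C` dim 101, known-liftable part dim 35). INVARIANT: `λᵢ(e) = Σ_{s∈Sᵢ} Σ_{u,v∈COMPᵢ} coeff(e_s; X_uX_vX_s)·uv
  ∈ Sym²(𝔽₅³)` — the degree-2 part of the determinant of the meridian Magnus–Fox matrix over `ℤ[H₁(Hᵢ)]`, which
  is a UNIT `±h'` (free `ℤ[H']`-module `𝔸ᵢ^{ab}`, Higman) for every automorphism stabilising `Nᵢ` (geometric lift
  via DNB; trivial mod `γ₃·5` via BMS + injectivity of `Λ³H⊗𝔽₅ → Hom(H,Λ²H/ω)⊗𝔽₅`; lift ambiguity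
  `D₂(H) ∩ Hom(H,[ω,H]) = ⟨ad_ω⟩`, dim 1, killed by `λ`), hence must have vanishing degree-2 part — while
  `rank λ = 15` on the candidates. CROSS-VALIDATION: Faes' Lagrangian trace `Tr^{Aᵢ}_2` (Topology Appl. 324
  (2023), arXiv:2206.10687, Thms A/B: `τ₂(𝒜₂) = ker Tr^A_2 ∩ Im τ₂`) agrees with `-λᵢ` identically on `E_F ∩ C`;
  both vanish on all known-liftable data; discriminating calibration on 168 honest Johnson-kernel automorphisms
  `h T' h⁻¹` (40 outside `G_N`): 0 violations, 40/40 detections. ONE WITNESS (datum, `𝔽₅`):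
  `a₀ ↦ [[a₀,b₀],b₁]`, `a₁ ↦ -[[a₀,b₀],b₀] + [[b₀,b₁],a₁]`, `b₁ ↦ [[b₀,b₁],b₁]`, `a₂ ↦ [[b₀,b₁],a₂]`,
  `b₂ ↦ [[b₀,b₁],b₂]`, `b₀ ↦ 0` (= `ad_{[b₀,b₁]}` + a small correction), `λ₀ ≠ 0`: a symmetry of all three level-`V`
  shadows, trivial on the class-2 quotient, congruent mod `V` to NO element of `Stab N₀`. CONSEQUENCE: the units of
  §6/§8 are NOT the only obstruction; the strengthening `NormalisedLevelSymmetriesLift` (§10 below, implied by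
  `LevelSymmetriesLift`) is FALSE; after the unit torus a proof must normalise a second-order torsor of "Alexander
  units" (Magnus determinants over `ℤ[H₁(Hᵢ)]/Iᵏ` mod `p`, i.e. the Morita–Faes trace hierarchy for the
  trisection group) — the level-coherence problem is at least the Johnson–Morita theory of `G_N`. (Not
  formalisable here: DNB, BMS, Labute, Fox calculus; the seat files carry the full certificate chain.)
* §5 (GEN 3 refresh) TARGETS: skeleton `61a205dfc496` of the lead (line epi-class-livingston),
  stubs `stub_latticeIdentity` (provable now: ideator-2's `tripleMeetCommutator_holds`),
  `stub_autFreeGroupRealisesGL` (Nielsen: `Aut F₃ ↠ GL₃(ℤ)`, rows = exponent vectors; TRUE),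
  `stub_framingZero`, `stub_constantAvatarPos`, `stub_separation`, `stub_cancellation` (each a
  consequence of the crux by the skeleton's `parts_of_crux`, hence not refutable below crux
  strength; drefute gen 2 concurs). payload.stuck_stubs = []: nothing to kill this cycle.
* LITERATURE (cycle 3): searchd/OpenAlex/S2/arXiv all degraded this session (rc 75 / 429 / ERR,
  logged); no new certified non-standard trisection of a homotopy `S⁴` known to this seat; the
  trisection group `G_N` of the genus-3 trisection of `S⁴` (needed to decide §9's seven
  directions) was not found computed in print (zbMATH up: nearest are Chen–Zou 2025, genus-3
  Goeritz groups of connected sums of two lens spaces, PJM 338; Cho–Koda–Lee 2026, Powell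
  conjecture at genus 3; Faes 2023 / Habiro–Massuyeau 2026 / Omori 2019 for the handlebody
  Torelli side — see §9).
* LITERATURE (cycle 2): see §4; no certified non-standard balanced trisection of a homotopy
  `S⁴` in print as of this cycle (searches logged in the seat NOTES); `ledger negatives`: none new.
-/

noncomputable section

namespace Summit.SmoothPoincare4.SmoothPoincare4.Cruxes.ShadowApproximation.Disproof

set_option linter.dupNamespace false

open Literature.Topology.FourManifolds
open Summit.SmoothPoincare4.SmoothPoincare4.Theses.CongruenceShadows

/-! ## §0 The crux read back -/

/-- `S_g` at the crux's genus `g = 3 + 3m`. -/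
abbrev S (m : ℕ) : Type := SurfaceGroup (3 + 3 * m)

/-- The standard kernel triple `N = s4Kernels # … # s4Kernels` of genus `3 + 3m`. -/
abbrev N (m : ℕ) : TrisectionKernels (3 + 3 * m) := s4Kernels.stabilizeIter m

/-- Waldhausen normalisation: each pair of slots is simultaneously standard. -/
def Pairs (m : ℕ) (K : TrisectionKernels (3 + 3 * m)) : Prop :=
  ∀ i j : Fin 3, i ≠ j → ∃ α : S m ≃* S m,
    (N m i).map α.toMonoidHom = K i ∧ (N m j).map α.toMonoidHom = K j

/-- Standard shadows in every characteristic finite quotient. -/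
def Shadows (m : ℕ) (K : TrisectionKernels (3 + 3 * m)) : Prop :=
  ∀ M : Subgroup (S m), M.Characteristic → M.FiniteIndex →
    ∃ ψ : S m ≃* S m, ∀ i : Fin 3, (N m i ⊔ M).map ψ.toMonoidHom = K i ⊔ M

/-- READ-BACK: the crux is literally `∀ m K, IsGroupTrisection → Pairs → Shadows → Iso N K`. -/
theorem shadowApproximation_iff :
    ShadowApproximation ↔ ∀ (m : ℕ) (K : TrisectionKernels (3 + 3 * m)),
      IsGroupTrisection (3 + 3 * m) (m + 1) (PUnit : Type) K → Pairs m K → Shadows m K →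
        TrisectionKernels.Iso (N m) K :=
  Iff.rfl

/-- Genus bookkeeping is definitional: `N 0 = s4Kernels`, `N (m+1) = (N m).stabilize`. -/
theorem N_zero : N 0 = s4Kernels := rfl

theorem N_succ (m : ℕ) : N (m + 1) = (N m).stabilize := rfl

/-! ## §1 Non-vacuity: the standard triple satisfies every hypothesis -/

/-- `N m` is a `(3+3m, m+1)` group trisection of the trivial group (induction on `m` from the two
discharged facts of `GroupTrisections.lean`). -/
theorem isGroupTrisection_std (m : ℕ) :
    IsGroupTrisection (3 + 3 * m) (m + 1) (PUnit : Type) (N m) := by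
  induction m with
  | zero => exact s4Kernels_isGroupTrisection_holds
  | succ m ih => exact stabilize_isGroupTrisection_holds _ _ _ _ ih

/-- All three hypotheses hold at `K = N m`, and so does the conclusion. -/
theorem hypotheses_hold_std (m : ℕ) :
    IsGroupTrisection (3 + 3 * m) (m + 1) (PUnit : Type) (N m) ∧ Pairs m (N m) ∧ Shadows m (N m) ∧
      TrisectionKernels.Iso (N m) (N m) :=
  ⟨isGroupTrisection_std m, fun _ _ _ => ⟨MulEquiv.refl _, by simp, by simp⟩,
    fun _ _ _ => ⟨MulEquiv.refl _, fun _ => by simp⟩, TrisectionKernels.Iso.refl _⟩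

/-- Hence the hypotheses of the crux are satisfiable at every genus (no vacuity). -/
theorem hypotheses_satisfiable (m : ℕ) : ∃ K : TrisectionKernels (3 + 3 * m),
    IsGroupTrisection (3 + 3 * m) (m + 1) (PUnit : Type) K ∧ Pairs m K ∧ Shadows m K :=
  ⟨N m, (hypotheses_hold_std m).1, (hypotheses_hold_std m).2.1, (hypotheses_hold_std m).2.2.1⟩

/-! ## §2 Logical position of the crux -/

/-- The crux with the shadow hypothesis DROPPED: every Waldhausen-normalised balanced group
trisection of `{1}` is standard at its own genus (= SPC4_g ∧ balanced 4-d Waldhausen_g, AGK p.3). -/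
def UnstableGate : Prop :=
  ∀ (m : ℕ) (K : TrisectionKernels (3 + 3 * m)),
    IsGroupTrisection (3 + 3 * m) (m + 1) (PUnit : Type) K → Pairs m K → TrisectionKernels.Iso (N m) K

/-- The crux with the normalisation hypothesis DROPPED. -/
def WithoutPairs : Prop :=
  ∀ (m : ℕ) (K : TrisectionKernels (3 + 3 * m)),
    IsGroupTrisection (3 + 3 * m) (m + 1) (PUnit : Type) K → Shadows m K → TrisectionKernels.Iso (N m) K

/-- Dropping `hS` only strengthens: `UnstableGate → ShadowApproximation`. -/
theorem shadowApproximation_of_unstableGate (h : UnstableGate) : ShadowApproximation :=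
  fun m K hK hW _ => h m K hK hW

/-- Under the sibling crux `ShadowsStandard` (14593) the shadow hypothesis is free, so the crux IS
the unstable gate. -/
theorem shadowApproximation_iff_unstableGate (hB : ShadowsStandard) :
    ShadowApproximation ↔ UnstableGate :=
  ⟨fun h m K hK hW => h m K hK hW (hB m K hK), shadowApproximation_of_unstableGate⟩

/-- `Iso` is symmetric (inverse automorphism). -/
theorem iso_symm {g : ℕ} {K K' : TrisectionKernels g} (h : TrisectionKernels.Iso K K') :
    TrisectionKernels.Iso K' K := by
  obtain ⟨α, hα⟩ := h
  refine ⟨α.symm, fun i => ?_⟩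
  rw [← hα i, Subgroup.map_map]
  convert Subgroup.map_id (K i)
  ext x
  simp

/-- The unstable gate closes the route target with NO stabilisation (`n = 0`). -/
theorem normalFormStablyTrivial_of_unstableGate (h : UnstableGate) : NormalFormStablyTrivial :=
  fun m K hK hW => ⟨0, m, rfl, iso_symm (h m K hK hW)⟩

/-- MUTATION `hW`: given the sibling crux `WaldhausenPairs` (14592, a theorem in print) the
normalisation hypothesis is redundant. -/
theorem shadowApproximation_iff_withoutPairs (hWP : WaldhausenPairs) :
    ShadowApproximation ↔ WithoutPairs :=
  ⟨fun h m K hK hS => h m K hK (hWP m K hK) hS, fun h m K hK _ hS => h m K hK hS⟩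

/-! ## §3 Load-bearing: `IsGroupTrisection` (proved in `Theorems/…/Negative/ShadowsOnlyFalse.lean`) -/

open Summit.SmoothPoincare4.SmoothPoincare4.Theorems.ShadowApproximation.Negative in
/-- **`IsGroupTrisection` is load-bearing** (landed, p73171): with it and `hW` dropped — keeping
normality of the kernels and the shadow hypothesis VERBATIM — the crux is false (genus 3, junk
triple `(N₀, N₁, N₂ ⊓ ker θ)`). -/
theorem shadowApproximation_false_without_isGroupTrisection :
    ¬ ∀ (m : ℕ) (K : TrisectionKernels (3 + 3 * m)), (∀ i, (K i).Normal) → Shadows m K →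
      TrisectionKernels.Iso (N m) K :=
  fun h => Summit.SmoothPoincare4.SmoothPoincare4.Theorems.ShadowApproximation.Negative.shadowApproximation_false_without_isGroupTrisection
    fun m K hn hS => h m K hn hS

open Summit.SmoothPoincare4.SmoothPoincare4.Theorems.ShadowApproximation.Negative in
/-- The sharp genus-3 form (landed): even level-wise EQUAL shadows for every finite-index NORMAL
`M`, two slots literally standard and the third INSIDE `N₂` do not force `Iso`. -/
theorem not_iso_of_shadows_only :
    ¬ ∀ K : TrisectionKernels 3, (∀ i, (K i).Normal) → K 0 = s4Kernels 0 → K 1 = s4Kernels 1 →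
      K 2 ≤ s4Kernels 2 →
      (∀ M : Subgroup (SurfaceGroup 3), M.Normal → M.FiniteIndex → ∀ i : Fin 3,
        s4Kernels i ⊔ M = K i ⊔ M) →
      TrisectionKernels.Iso s4Kernels K :=
  Summit.SmoothPoincare4.SmoothPoincare4.Theorems.ShadowApproximation.Negative.not_iso_of_shadows_only

open Summit.SmoothPoincare4.SmoothPoincare4.Theorems.ShadowApproximation.Negative in
/-- The witness, for importers: `junk = ![N₀, N₁, N₂ ⊓ ker θ]` has standard shadows at every
finite-index normal level with `ψ = id` … -/
theorem junk_shadows' (M : Subgroup (SurfaceGroup 3)) [M.Normal] [M.FiniteIndex] (i : Fin 3) :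
    s4Kernels i ⊔ M = junk i ⊔ M :=
  junk_shadows M i

open Summit.SmoothPoincare4.SmoothPoincare4.Theorems.ShadowApproximation.Negative in
/-- … and is not isomorphic to the standard triple. -/
theorem not_iso_junk' : ¬ TrisectionKernels.Iso s4Kernels junk :=
  not_iso_junk

/-! ### Fields (landed, p73918 — `Theorems/ShadowApproximation/Negative/ShadowsOnlyFalseFields.lean`) -/

open Summit.SmoothPoincare4.SmoothPoincare4.Theorems.ShadowApproximation.Negative in
/-- WHICH trisection conditions the junk violates (imported): `π₁ = 1` HOLDS, pairs `(0,1)`,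
`(1,2)` free of rank 1, `free_quotient 0, 1` hold; exactly `free_quotient 2` and
`free_pairQuotient (0,2)` fail. So a proof must use the freeness of `S ⧸ K₂` or of one pair
quotient. -/
theorem junk_fields :
    Nonempty (junk.tripleQuotient ≃* (PUnit : Type)) ∧ IsFreeOfRank (junk.pairQuotient 0 1) 1 ∧
      IsFreeOfRank (junk.pairQuotient 1 2) 1 ∧
      (∀ n, ¬ IsFreeOfRank (SurfaceGroup 3 ⧸ Subgroup.normalClosure (junk 2 : Set (SurfaceGroup 3))) n) ∧
      (∀ n, ¬ IsFreeOfRank (junk.pairQuotient 0 2) n) :=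
  ⟨junk_triple, junk_free_pairQuotient_01, junk_free_pairQuotient_12, junk_not_free_quotient_two,
    junk_not_free_pairQuotient_02⟩

/-! ## §6 (cycle 2) The units obstruction: strong approximation / level-symmetry lifting is false

LANDED part (`Negative/UnitTwist.lean`, p75257; imported): the twists, the unit twist `δ`, the level
`M₅`, and `δ`'s level-5 behaviour — restated below. ALSO LANDED (`Negative/LevelSymmetriesFalse.lean`
p77641, `Negative/Slides.lean` p77784; axioms standard), quoted here (namespace
`…Theorems.ShadowApproximation.Negative`) and imported from v6 on (check-farm build lag):

```
theorem mulEquiv_infinite_cyclic (e : FreeGroup (Fin 1) ≃* G) (β : G ≃* G) :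
    ∃ k : ℤ, (k = 1 ∨ k = -1) ∧ ∀ x, β x = x ^ k
theorem chi_alpha_b0 (α) (h0 : (s4Kernels 0).map α = s4Kernels 0) (h1 : (s4Kernels 1).map α = s4Kernels 1) :
    chi (α (b 0)) = ofAdd 1 ∨ chi (α (b 0)) = (ofAdd 1)⁻¹          -- χ = χ_{b₀} : S₃ → 𝔽₅
theorem chi_delta_b0 : chi (delta (b 0)) = ofAdd 2
theorem not_lift_delta : ¬ ∃ α : S ≃* S, (s4Kernels 0).map α = s4Kernels 0 ∧
    (s4Kernels 1).map α = s4Kernels 1 ∧ ∀ s, delta s * (α s)⁻¹ ∈ M5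
theorem not_levelSymmetriesLift : ¬ (LevelSymmetriesLift, inlined)
theorem not_strongShadowApproximation : ¬ (StrongShadowApproximation, inlined)
-- Slides.lean
def slide01 : S ≃* S          -- a₀ ↦ a₀, b₀ ↦ a₀⁻¹a₁a₀b₀, a₁ ↦ a₀⁻¹a₁a₀, b₁ ↦ a₁b₁a₁⁻¹a₀, h2 conj by a₁
theorem slide01_stab (i : Fin 3) : (s4Kernels i).map slide01 = s4Kernels i
theorem toCommGroup_comp_slide01 (v) : (toCommGroup v).comp slide01 = toCommGroup (slideVal v)
    -- slideVal v (0,true) = v(1,false) * v(0,true); slideVal v (1,true) = v(1,true) * v(0,false)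
```
-/

section landed
open Summit.SmoothPoincare4.SmoothPoincare4.Theorems.ShadowApproximation.Negative

/-- (landed, p75257) **The unit twist is a symmetry of all three level-5 shadows of `N`**:
`δ(Nᵢ ⊔ M₅) = Nᵢ ⊔ M₅`, `M₅` characteristic of finite index — so `(M₅, δ)` is an admissible
instance of the hypothesis of `LevelSymmetriesLift` at `m = 0`. -/
theorem delta_is_level_symmetry :
    M5.Characteristic ∧ M5.FiniteIndex ∧
      ∀ i : Fin 3, (s4Kernels i ⊔ M5).map delta.toMonoidHom = s4Kernels i ⊔ M5 :=
  ⟨M5_characteristic, M5_finiteIndex, delta_level⟩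

/-- (landed, p75257) … while mod `5` it multiplies `a₀` by `3` and `b₀` by `2`: for every hom
`χ_v : S₃ → 𝔽₅`, `χ_v (δ b₀) = v(b₀)²` — the scalar `2 ∉ {±1}` on the survivor `b₀` of the pair
`(0,1)` is the obstruction. -/
theorem delta_scalar_b0 (v : surfaceGen 3 → Multiplicative (ZMod 5)) :
    homZ5 v (delta (SurfaceGroup.b 0)) = v (0, true) ^ 2 := by
  have := DFunLike.congr_fun (homZ5_delta v) (SurfaceGroup.b 0)
  simpa [cδ] using this

end landed

/-- STRENGTHENING (Artin-style strong approximation): every level-`M` standardisation `ψ` of a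
normalised group trisection `K` of `{1}` is congruent mod `M` to an isomorphism `N ≅ K`.
FALSE (`not_strongShadowApproximation`, landed p77641; see §6 docblock). -/
def StrongShadowApproximation : Prop :=
  ∀ (m : ℕ) (K : TrisectionKernels (3 + 3 * m)),
    IsGroupTrisection (3 + 3 * m) (m + 1) (PUnit : Type) K → Pairs m K →
    ∀ M : Subgroup (S m), M.Characteristic → M.FiniteIndex →
    ∀ ψ : S m ≃* S m, (∀ i : Fin 3, (N m i ⊔ M).map ψ.toMonoidHom = K i ⊔ M) →
      ∃ α : S m ≃* S m, (∀ i, (N m i).map α.toMonoidHom = K i) ∧ ∀ s, ψ s * (α s)⁻¹ ∈ M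

/-- STRENGTHENING (`K = N`): every symmetry of the level-`M` shadow of the standard trisection is
congruent mod `M` to a symmetry of the standard trisection. FALSE at `m = 0`, `M = M₅`, `ψ = δ`
(`not_levelSymmetriesLift`, landed p77641). -/
def LevelSymmetriesLift : Prop :=
  ∀ (m : ℕ) (M : Subgroup (S m)), M.Characteristic → M.FiniteIndex →
    ∀ ψ : S m ≃* S m, (∀ i : Fin 3, (N m i ⊔ M).map ψ.toMonoidHom = N m i ⊔ M) →
      ∃ α : S m ≃* S m, (∀ i, (N m i).map α.toMonoidHom = N m i) ∧ ∀ s, ψ s * (α s)⁻¹ ∈ M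

/-- The strong form implies the crux — in fact already the unstable gate, using only the trivial
level `M = ⊤` (so as a proof target it was always too strong; the point of §6 is that it fails at
`K = N`, where the gate's conclusion holds, i.e. the failure is about LIFTING `ψ_M`, not about `K`). -/
theorem unstableGate_of_strong (h : StrongShadowApproximation) : UnstableGate := by
  intro m K hK hW
  obtain ⟨α, hα, -⟩ := h m K hK hW ⊤ inferInstance inferInstance (MulEquiv.refl _)
    (fun i => by simp)
  exact ⟨α, hα⟩

/-- Hence `StrongShadowApproximation → ShadowApproximation`. -/
theorem shadowApproximation_of_strong (h : StrongShadowApproximation) : ShadowApproximation :=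
  shadowApproximation_of_unstableGate (unstableGate_of_strong h)

/-- The strong form specialises to `LevelSymmetriesLift` at `K = N`. -/
theorem levelSymmetriesLift_of_strong (h : StrongShadowApproximation) : LevelSymmetriesLift :=
  fun m M hM hF ψ hψ => h m _ (isGroupTrisection_std m) (hypotheses_hold_std m).2.1 M hM hF ψ hψ

/-- NORMALISABILITY remark, formal part: the crux only needs SOME coherent choice; a level
symmetry `u` of `N`'s shadows (e.g. a unit twist) can always be absorbed into `ψ_M`
(`ψ_M ∘ u` is again a standardisation). -/
theorem shadows_absorb {m : ℕ} {K : TrisectionKernels (3 + 3 * m)} {M : Subgroup (S m)}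
    {ψ u : S m ≃* S m} (hψ : ∀ i : Fin 3, (N m i ⊔ M).map ψ.toMonoidHom = K i ⊔ M)
    (hu : ∀ i : Fin 3, (N m i ⊔ M).map u.toMonoidHom = N m i ⊔ M) (i : Fin 3) :
    (N m i ⊔ M).map (u.trans ψ).toMonoidHom = K i ⊔ M := by
  have e : (u.trans ψ).toMonoidHom = ψ.toMonoidHom.comp u.toMonoidHom := rfl
  rw [e, ← Subgroup.map_map, hu i, hψ i]

/-! ## §7 (cycle 2) Tightness: identity shadows + separability force equality -/

/-- `H ≤ G` is separable with respect to characteristic finite-index levels: every element outside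
`H` stays outside `H ⊔ M` for some characteristic finite-index `M`. True for handlebody kernels
`Kᵢ ◁ S_g` (`S ⧸ Kᵢ ≅ F_g` residually finite; finite-index subgroups of the finitely generated `S`
contain characteristic finite-index ones) — not formalised here; FALSE for gen 1's junk `J₂`. -/
def CharSeparable {G : Type*} [Group G] (H : Subgroup G) : Prop :=
  ∀ x, x ∉ H → ∃ M : Subgroup G, M.Characteristic ∧ M.FiniteIndex ∧ x ∉ H ⊔ M

/-- **Identity shadows + separability ⇒ equality.** If `H ⊔ M = L ⊔ M` at every characteristic
finite-index level and both are `CharSeparable`, then `H = L`. With §3: identity shadows do occur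
for `J ≠ N` (junk, not separable), never for separable rivals — the crux's whole difficulty is the
level-dependence of `ψ_M` (§6). -/
theorem eq_of_idShadows {G : Type*} [Group G] {H L : Subgroup G} (hH : CharSeparable H)
    (hL : CharSeparable L)
    (h : ∀ M : Subgroup G, M.Characteristic → M.FiniteIndex → H ⊔ M = L ⊔ M) : H = L := by
  ext x
  constructor
  · intro hx
    by_contra hxL
    obtain ⟨M, hM, hF, hx'⟩ := hL x hxL
    exact hx' (h M hM hF ▸ Subgroup.mem_sup_left hx)
  · intro hx
    by_contra hxH
    obtain ⟨M, hM, hF, hx'⟩ := hH x hxH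
    exact hx' ((h M hM hF).symm ▸ Subgroup.mem_sup_left hx)

/-- The junk kernel `J₂` of §3 is NOT `CharSeparable` (it has the identity shadows of `N₂ ≠ J₂`). -/
theorem not_charSeparable_J2 :
    ¬ CharSeparable Summit.SmoothPoincare4.SmoothPoincare4.Theorems.ShadowApproximation.Negative.J2 := by
  intro hJ
  have hb := Summit.SmoothPoincare4.SmoothPoincare4.Theorems.ShadowApproximation.Negative.b0_not_mem_J2
  obtain ⟨M, hM, hF, hx⟩ := hJ _ hb
  haveI := hM
  haveI := hF
  haveI : M.Normal := inferInstance
  apply hx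
  rw [← Summit.SmoothPoincare4.SmoothPoincare4.Theorems.ShadowApproximation.Negative.N2_sup_eq_J2_sup M]
  exact Subgroup.mem_sup_left
    Summit.SmoothPoincare4.SmoothPoincare4.Theorems.ShadowApproximation.Negative.b0_mem_N2

/-- Uniform version relevant to the crux: if ONE automorphism `ψ` standardises the shadows at every
characteristic finite-index level and the kernels are `CharSeparable`, then `ψ` is an isomorphism
of trisections. (So coherence of the `ψ_M` is exactly what is missing.) -/
theorem iso_of_uniform_shadows {m : ℕ} {K : TrisectionKernels (3 + 3 * m)} (ψ : S m ≃* S m)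
    (hK : ∀ i, CharSeparable (K i)) (hN : ∀ i, CharSeparable ((N m i).map ψ.toMonoidHom))
    (h : ∀ M : Subgroup (S m), M.Characteristic → M.FiniteIndex →
      ∀ i : Fin 3, (N m i ⊔ M).map ψ.toMonoidHom = K i ⊔ M) :
    TrisectionKernels.Iso (N m) K := by
  refine ⟨ψ, fun i => eq_of_idShadows (hN i) (hK i) fun M hM hF => ?_⟩
  rw [← h M hM hF i, Subgroup.map_sup, (Subgroup.characteristic_iff_map_eq.1 hM) ψ]

/-! ## §8 (gen 3) Units never die — the eventual strengthening and its refutation (landing file)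

The Lean proofs live in the seat file `Tower.lean` / landing file `Negative/UnitTwistTower.lean`
(imports `Negative/LevelSymmetriesFalse.lean`; imported here from v7 on, once built on the farm):
```
def deltaT (t t' : ℤ) : MulAut S := tA ^ t * tB ^ (-t') * tA ^ (t - 1) * tB * tA⁻¹
theorem map_deltaT_a0_of_a0 (f : S →* Q) (ha : f (a 0) = 1) : f (deltaT t t' (a 0)) = f (b 0) ^ (-(t*t'-1))
theorem map_deltaT_b0_of_b0 (f : S →* Q) (hb : f (b 0) = 1) : f (deltaT t t' (b 0)) = f (a 0) ^ (t*t'-1)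
theorem map_deltaT_b0_of_a0 (f : S →* Q) (ha : f (a 0) = 1) : f (deltaT t t' (b 0)) = f (b 0) ^ t'
theorem deltaT_level (hn : (n:ℤ) ∣ t*t'-1) (M) [M.Characteristic] [M.FiniteIndex] (hMn : ∀ x, x^n ∈ M) (i) :
    (s4Kernels i ⊔ M).map (deltaT t t') = s4Kernels i ⊔ M
theorem not_lift_deltaT (ht1 : (t':ZMod 5) ≠ 1) (ht2 : (t':ZMod 5) ≠ -1) (M) (hM : M ≤ chi.ker) :
    ¬ ∃ α, α N₀ = N₀ ∧ α N₁ = N₁ ∧ ∀ s, deltaT t t' s * (α s)⁻¹ ∈ M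
theorem unit_twist_tower (M) [char] [f.i.] (h5 : ∀ x, x^5 ∈ M) (hle : M ≤ M5) : (level ∧ ¬ lift) for δ(3,2)
theorem levelSymmetriesLift_fails_cofinally (M₀) [char] [f.i.] :
    ∃ M ≤ M₀, char ∧ f.i. ∧ ∃ ψ, (∀ i, ψ(Nᵢ ⊔ M) = Nᵢ ⊔ M) ∧ ¬ ∃ α, α N₀ = N₀ ∧ α N₁ = N₁ ∧ ψ ≡ α mod M
theorem not_eventualLevelSymmetriesLift : ¬ (EventualLevelSymmetriesLift, inlined at genus 3)
```
-/

/-- STRENGTHENING "EventualLevelSymmetriesLift" (the natural retreat from §6's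
`LevelSymmetriesLift` after the unit twist): at genus 3, beyond SOME characteristic finite-index
level `M₀`, every symmetry of the level-`M` shadow triple `(N₀M, N₁M, N₂M)` of the standard
trisection is congruent mod `M` to an automorphism stabilising `N₀` and `N₁`. FALSE
(`not_eventualLevelSymmetriesLift`, seat `Tower.lean` rc 0 / `Negative/UnitTwistTower.lean`):
below every `M₀` the level `M₀ ⊓ M₅` carries a unit twist `δ(t,t')` with scalar `t' ≡ 2 (mod 5)` on
`b₀`. -/
def EventualLevelSymmetriesLift : Prop :=
  ∃ M₀ : Subgroup (S 0), M₀.Characteristic ∧ M₀.FiniteIndex ∧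
    ∀ M : Subgroup (S 0), M.Characteristic → M.FiniteIndex → M ≤ M₀ →
      ∀ ψ : S 0 ≃* S 0, (∀ i : Fin 3, (N 0 i ⊔ M).map ψ.toMonoidHom = N 0 i ⊔ M) →
        ∃ α : S 0 ≃* S 0, (N 0 0).map α.toMonoidHom = N 0 0 ∧
          (N 0 1).map α.toMonoidHom = N 0 1 ∧ ∀ s, ψ s * (α s)⁻¹ ∈ M

/-- `LevelSymmetriesLift` (§6, already refuted at `M₅`) implies the eventual form (take `M₀ = ⊤`);
§8 refutes even the eventual form, i.e. the failure is cofinal in the level poset. -/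
theorem eventual_of_levelSymmetriesLift (h : LevelSymmetriesLift) : EventualLevelSymmetriesLift := by
  refine ⟨⊤, inferInstance, inferInstance, fun M hM hF _ ψ hψ => ?_⟩
  obtain ⟨α, hα, hc⟩ := h 0 M hM hF ψ hψ
  exact ⟨α, hα 0, hα 1, hc⟩

/-- The unit-twist family at the level of statements: `δ(t,t')`'s defining property used in §8 —
modulo `a₀` it is `b₀ ↦ b₀^{t'}` up to `n`-th powers. Recorded here as the elementary number fact
behind "units never die": for every modulus `n > 1` there is a unit `t' (mod n)` with
`t' ≡ 2 (mod 5)` (so `∉ {±1} mod 5`), namely `t' = m⁴ + 1`, `m = ordCompl[5] n`. [folklore] -/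
theorem exists_bad_unit (n : ℕ) (hn : 1 < n) : ∃ t t' : ℤ, (n : ℤ) ∣ t * t' - 1 ∧ (t' : ZMod 5) = 2 := by
  have hn0 : n ≠ 0 := by omega
  have h5 : Nat.Prime 5 := by norm_num
  have hm5 : ¬ 5 ∣ ordCompl[5] n := Nat.not_dvd_ordCompl h5 hn0
  set m : ℕ := ordCompl[5] n with hm
  have hcast : ((m ^ 4 + 1 : ℕ) : ZMod 5) = 2 := by
    haveI : Fact (Nat.Prime 5) := ⟨h5⟩
    have h : (m : ZMod 5) ≠ 0 := by rwa [Ne, ZMod.natCast_eq_zero_iff]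
    have h4 : (m : ZMod 5) ^ 4 = 1 := ZMod.pow_card_sub_one_eq_one h
    push_cast
    rw [h4]
    rfl
  have hcop_m : Nat.Coprime (m ^ 4 + 1) m := by
    have h := (Nat.coprime_add_mul_right_right m 1 (m ^ 3)).2 (Nat.coprime_one_right m)
    rw [show 1 + m ^ 3 * m = m ^ 4 + 1 by ring] at h
    exact h.symm
  have hcop_5 : Nat.Coprime (m ^ 4 + 1) 5 := by
    rw [Nat.coprime_comm, Nat.Prime.coprime_iff_not_dvd h5, ← ZMod.natCast_eq_zero_iff, hcast]
    decide
  have hcop : Nat.Coprime (m ^ 4 + 1) n := by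
    rw [← Nat.ordProj_mul_ordCompl_eq_self n 5]
    exact Nat.Coprime.mul_right (hcop_5.pow_right _) hcop_m
  obtain ⟨t, -, ht⟩ := Nat.exists_mul_mod_eq_one_of_coprime hcop hn
  have hq : (m ^ 4 + 1) * t = n * ((m ^ 4 + 1) * t / n) + 1 := by
    have := Nat.div_add_mod ((m ^ 4 + 1) * t) n
    rw [ht] at this
    omega
  refine ⟨t, (m ^ 4 + 1 : ℕ), ⟨(((m ^ 4 + 1) * t / n : ℕ) : ℤ), ?_⟩, by exact_mod_cast hcast⟩
  have := congrArg (Nat.cast : ℕ → ℤ) hq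
  push_cast at this ⊢
  linarith

/-! ## §10 (gen 3) Alexander units — the normalised strengthening (statement; refuted by computation) -/

/-- STRENGTHENING "NormalisedLevelSymmetriesLift" (the natural retreat from `LevelSymmetriesLift` after the unit
torus of §6/§8): at genus 3, every symmetry `ψ` of the level-`M` shadow triple `(N₀M, N₁M, N₂M)` that acts
TRIVIALLY modulo `M₅` (so in particular with unit scalars `+1` on the three pair quotients) is congruent mod `M`
to a symmetry of `N`. FALSE at `M = V = γ₄(S₃)S₃⁵` by the computational theorem of §10 (seat
`AlexanderUnits.md`): the witnesses even act trivially on `S₃/γ₃(S₃)S₃⁵` and are congruent mod `V` to no element of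
a single `Stab Nᵢ`. Not refuted in Lean (the certificate uses DNB, BMS, Fox calculus and a machine computation). -/
def NormalisedLevelSymmetriesLift : Prop :=
  ∀ M : Subgroup (S 0), M.Characteristic → M.FiniteIndex →
    ∀ ψ : S 0 ≃* S 0, (∀ i : Fin 3, (N 0 i ⊔ M).map ψ.toMonoidHom = N 0 i ⊔ M) →
      (∀ s, ψ s * s⁻¹ ∈ Summit.SmoothPoincare4.SmoothPoincare4.Theorems.ShadowApproximation.Negative.M5) →
        ∃ α : S 0 ≃* S 0, (∀ i, (N 0 i).map α.toMonoidHom = N 0 i) ∧ ∀ s, ψ s * (α s)⁻¹ ∈ M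

/-- `LevelSymmetriesLift` (§6) implies the normalised form (drop the normalisation hypothesis); §10 refutes even
the normalised form (by computation), §6/§8 the unnormalised one (in Lean). -/
theorem normalised_of_levelSymmetriesLift (h : LevelSymmetriesLift) : NormalisedLevelSymmetriesLift :=
  fun M hM hF ψ hψ _ => h 0 M hM hF ψ hψ

end Summit.SmoothPoincare4.SmoothPoincare4.Cruxes.ShadowApproximation.Disproof

end
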